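import Mathlib

/-!
# LEVEL-RAISING INJECTIONS IN THE BOOLEAN LATTICE (night-3 g26)

`proofs/NIGHT3-G26-TWOFLATS.md` §4.  For a finite set `S` and `i ≤ j` with `i + j ≤ #S` there is an injective map
from the `i`-subsets of `S` to the `j`-subsets of `S` sending every set to a superset of itself
(`exists_injOn_powersetCard_subset`).  Proof: Hall's theorem on the bipartite graph `I ⊆ J` between the two
levels, whose degrees are `C(#S − i, j − i)` on the left (`card_filter_supersets`) and at most `C(j, i)` on the
right, and `C(j, i) ≤ C(#S − i, j − i)` when `i + j ≤ #S` (double counting, `Finset.card_mul_le_card_mul`).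
This is the absorber's move of the two-flat injection (the partial complement `(I, D) ↦ (F ∖ φ(I), …)`).
No `def`, no `instance`, no notation.  Axioms: standard.
-/

namespace PercRepro

namespace LevelInj

open Finset

variable {α : Type} [DecidableEq α]

/-- The `j`-subsets of `S` containing a given `I ⊆ S` with `#I ≤ j` number `C(#S − #I, j − #I)`. -/
theorem card_filter_supersets (S I : Finset α) (hI : I ⊆ S) {j : ℕ} (hij : I.card ≤ j) :
    ((S.powersetCard j).filter (fun J => I ⊆ J)).card = (S.card - I.card).choose (j - I.card) := by
  have h1 : (S.card - I.card).choose (j - I.card) = ((S \ I).powersetCard (j - I.card)).card := by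
    rw [card_powersetCard, card_sdiff_of_subset hI]
  rw [h1]
  apply card_bij (fun J _ => J \ I)
  · intro J hJ
    rw [mem_filter, mem_powersetCard] at hJ
    obtain ⟨⟨hJS, hJc⟩, hIJ⟩ := hJ
    rw [mem_powersetCard]
    exact ⟨sdiff_subset_sdiff hJS subset_rfl, by rw [card_sdiff_of_subset hIJ, hJc]⟩
  · intro J₁ hJ₁ J₂ hJ₂ h
    rw [mem_filter] at hJ₁ hJ₂
    have e1 := sdiff_union_of_subset hJ₁.2
    have e2 := sdiff_union_of_subset hJ₂.2
    rw [← e1, ← e2, h]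
  · intro T hT
    rw [mem_powersetCard] at hT
    obtain ⟨hTS, hTc⟩ := hT
    have hdisj : Disjoint T I := by
      have : Disjoint (S \ I) I := sdiff_disjoint
      exact this.mono_left hTS
    refine ⟨T ∪ I, ?_, ?_⟩
    · rw [mem_filter, mem_powersetCard]
      refine ⟨⟨?_, ?_⟩, subset_union_right⟩
      · exact union_subset (hTS.trans sdiff_subset) hI
      · rw [card_union_of_disjoint hdisj, hTc]
        omega
    · exact union_sdiff_cancel_right hdisj

/-- `C(j, i) ≤ C(n − i, j − i)` whenever `i ≤ j ≤ n − i`. -/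
theorem choose_le_choose_sub {n i j : ℕ} (hij : i ≤ j) (hn : i + j ≤ n) :
    j.choose i ≤ (n - i).choose (j - i) := by
  have h1 : j.choose i = j.choose (j - i) := by
    rw [Nat.choose_symm hij]
  rw [h1]
  exact Nat.choose_le_choose (j - i) (by omega)

/-- **Level-raising injection** (Hall): for `i ≤ j` with `i + j ≤ #S` there is a map `φ`, injective on the
`i`-subsets of `S`, sending every `i`-subset `I` to a `j`-subset `φ I ⊇ I` of `S`. -/
theorem exists_injOn_powersetCard_subset (S : Finset α) {i j : ℕ} (hij : i ≤ j) (hn : i + j ≤ S.card) :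
    ∃ φ : Finset α → Finset α, Set.InjOn φ (S.powersetCard i : Set (Finset α)) ∧
      ∀ I ∈ S.powersetCard i, φ I ∈ S.powersetCard j ∧ I ⊆ φ I := by
  -- the bipartite graph `I ⊆ J` between the levels, as a family indexed by the `i`-subsets
  let ι := {I : Finset α // I ∈ S.powersetCard i}
  let t : ι → Finset (Finset α) := fun I => (S.powersetCard j).filter (fun J => I.1 ⊆ J)
  have hdeg : ∀ I : ι, (t I).card = (S.card - i).choose (j - i) := by
    intro I
    have hI := I.2
    rw [mem_powersetCard] at hI
    show ((S.powersetCard j).filter (fun J => I.1 ⊆ J)).card = _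
    rw [card_filter_supersets S I.1 hI.1 (by omega), hI.2]
  have hall : ∀ A : Finset ι, A.card ≤ (A.biUnion t).card := by
    intro A
    have hdc := card_mul_le_card_mul (fun (I : ι) (J : Finset α) => I.1 ⊆ J) (s := A) (t := A.biUnion t)
      (m := (S.card - i).choose (j - i)) (n := j.choose i) ?_ ?_
    · have hpos : 0 < j.choose i := Nat.choose_pos hij
      have hle : j.choose i ≤ (S.card - i).choose (j - i) := choose_le_choose_sub hij hn
      have : A.card * j.choose i ≤ (A.biUnion t).card * j.choose i :=
        calc A.card * j.choose i ≤ A.card * (S.card - i).choose (j - i) := Nat.mul_le_mul_left _ hle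
          _ ≤ (A.biUnion t).card * j.choose i := hdc
      exact Nat.le_of_mul_le_mul_right this hpos
    · -- every `I ∈ A` has `C(#S − i, j − i)` supersets in the union
      intro I hI
      rw [← hdeg I]
      apply card_le_card
      intro J hJ
      rw [mem_bipartiteAbove]
      refine ⟨mem_biUnion.2 ⟨I, hI, hJ⟩, ?_⟩
      have hJ' : J ∈ (S.powersetCard j).filter (fun J => I.1 ⊆ J) := hJ
      rw [mem_filter] at hJ'
      exact hJ'.2
    · -- every `J` in the union has at most `C(j, i)` subsets of size `i` below it
      intro J hJ
      have hJj : J ∈ S.powersetCard j := by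
        rw [mem_biUnion] at hJ
        obtain ⟨I, _, hJI⟩ := hJ
        have hJI' : J ∈ (S.powersetCard j).filter (fun J => I.1 ⊆ J) := hJI
        rw [mem_filter] at hJI'
        exact hJI'.1
      rw [mem_powersetCard] at hJj
      calc (A.bipartiteBelow (fun (I : ι) (J : Finset α) => I.1 ⊆ J) J).card
          ≤ (J.powersetCard i).card := by
            apply card_le_card_of_injOn (fun I : ι => I.1)
            · intro I hI
              rw [coe_bipartiteBelow, Set.mem_setOf_eq] at hI
              have hIi := I.2
              rw [mem_powersetCard] at hIi
              rw [mem_coe, mem_powersetCard]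
              exact ⟨hI.2, hIi.2⟩
            · intro I₁ _ I₂ _ h
              exact Subtype.ext h
        _ = j.choose i := by rw [card_powersetCard, hJj.2]
  obtain ⟨f, hfinj, hft⟩ := (all_card_le_biUnion_card_iff_exists_injective t).1 hall
  classical
  refine ⟨fun I => if h : I ∈ S.powersetCard i then f ⟨I, h⟩ else ∅, ?_, ?_⟩
  · intro I₁ hI₁ I₂ hI₂ h
    rw [mem_coe] at hI₁ hI₂
    simp only [dif_pos hI₁, dif_pos hI₂] at h
    have := hfinj h
    exact congrArg Subtype.val this
  · intro I hI
    simp only [dif_pos hI]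
    have hf : f ⟨I, hI⟩ ∈ (S.powersetCard j).filter (fun J => I ⊆ J) := hft ⟨I, hI⟩
    rw [mem_filter] at hf
    exact hf

end LevelInj

end PercRepro
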